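import Summits.CriticalPhenomena.PercolationContinuityZ3.Theorems.PercNearOneGluingNoHeavyLowerTailMajorityGluingQCert
import HarnessLib

/-!
# Kernel evaluation of the degree-2 certificates, one row of the symmetrised coefficient array at a time (lane prim-rate, constants-miner 1, gen 34; NEXT-g34 item 1)

Support file for the closed crux `NoHeavyLowerTail` (stmt-CriticalPhenomena-4575), majority-gluing line; companion of `…MajorityGluingQCert`
(the certificate language, the SPECIFICATION `Cert.S i j` of the symmetrised coefficient of `x_i x_j` in `LHS − RHS`, the structural check
`checkW`).  Evaluating `S i j` pair by pair in the kernel costs `O(#entries)` per pair; here the whole row `(S i j)_{j < NV}` is accumulated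
in ONE pass over the entries as a list of integers (`Cert.svec`): a row `n·(f₃f₄ − f₁f₂)` with `i ∈ f₁` adds `n` at the set bits of the
mask of `f₂` (`vaddMask`), etc.  `svec_getD` proves that the `j`-th entry is `S i j`; `Cert.checkQ lo hi` checks the rows `lo ≤ i < hi`
(chunkable, `checkQ_append`), and `of_checkQ` returns `0 ≤ S i j`.  Pure list arithmetic; no sorries.
-/

namespace Summit.CriticalPhenomena.PercolationContinuityZ3.Theorems

namespace HubOnly
namespace QCert

/-! ### Vector primitives -/

/-- `acc_j += k` for every set bit `j` of `msk`. -/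
def vaddMask (k : ℤ) : List ℤ → ℕ → List ℤ
  | [], _ => []
  | a :: l, msk => cond (Nat.beq (msk % 2) 1) (a + k) a :: vaddMask k l (msk / 2)

/-- `acc_b += k`. -/
def vaddAt (k : ℤ) : List ℤ → ℕ → List ℤ
  | [], _ => []
  | a :: l, 0 => (a + k) :: l
  | a :: l, b + 1 => a :: vaddAt k l b

/-- `acc_j += f (j₀ + j)` for all positions `j`. -/
def vaddFn (f : ℕ → ℤ) : List ℤ → ℕ → List ℤ
  | [], _ => []
  | a :: l, j₀ => (a + f j₀) :: vaddFn f l (j₀ + 1)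

/-- The lowest bit as a raw `Nat.beq`. -/
theorem beq_mod_two (m : ℕ) : Nat.beq (m % 2) 1 = m.testBit 0 := by
  rw [Nat.testBit_zero]
  rcases Nat.mod_two_eq_zero_or_one m with h | h <;> rw [h] <;> rfl

/-- `vaddMask` preserves the length. -/
@[simp] theorem vaddMask_length (k : ℤ) : ∀ (l : List ℤ) (msk : ℕ), (vaddMask k l msk).length = l.length
  | [], _ => rfl
  | a :: l, msk => by simp [vaddMask, vaddMask_length k l]

/-- Entry `j` of `vaddMask k l msk` is `l_j + [bit j of msk]·k`. -/
theorem vaddMask_getD (k : ℤ) : ∀ (l : List ℤ) (msk j : ℕ), j < l.length →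
    (vaddMask k l msk).getD j 0 = l.getD j 0 + Cert.bi (tb msk j) * k
  | [], _, j, hj => by simp at hj
  | a :: l, msk, 0, _ => by
    rw [vaddMask, List.getD_cons_zero, List.getD_cons_zero, tb_eq, ← beq_mod_two]
    cases Nat.beq (msk % 2) 1 <;> simp [Cert.bi]
  | a :: l, msk, j + 1, hj => by
    rw [vaddMask, List.getD_cons_succ, List.getD_cons_succ, vaddMask_getD k l (msk / 2) j (by simpa using hj), tb_eq, tb_eq,
      Nat.testBit_succ]

/-- `vaddAt` preserves the length. -/
@[simp] theorem vaddAt_length (k : ℤ) : ∀ (l : List ℤ) (b : ℕ), (vaddAt k l b).length = l.length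
  | [], _ => rfl
  | a :: l, 0 => rfl
  | a :: l, b + 1 => by simp [vaddAt, vaddAt_length k l b]

/-- Entry `j` of `vaddAt k l b` is `l_j + [j = b]·k`. -/
theorem vaddAt_getD (k : ℤ) : ∀ (l : List ℤ) (b j : ℕ), j < l.length →
    (vaddAt k l b).getD j 0 = l.getD j 0 + if b = j then k else 0
  | [], _, j, hj => by simp at hj
  | a :: l, 0, 0, _ => by simp [vaddAt]
  | a :: l, 0, j + 1, _ => by simp [vaddAt]
  | a :: l, b + 1, 0, _ => by simp [vaddAt]
  | a :: l, b + 1, j + 1, hj => by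
    rw [vaddAt, List.getD_cons_succ, List.getD_cons_succ, vaddAt_getD k l b j (by simpa using hj)]
    simp

/-- `vaddFn` preserves the length. -/
@[simp] theorem vaddFn_length (f : ℕ → ℤ) : ∀ (l : List ℤ) (j₀ : ℕ), (vaddFn f l j₀).length = l.length
  | [], _ => rfl
  | a :: l, j₀ => by simp [vaddFn, vaddFn_length f l]

/-- Entry `j` of `vaddFn f l j₀` is `l_j + f (j₀ + j)`. -/
theorem vaddFn_getD (f : ℕ → ℤ) : ∀ (l : List ℤ) (j₀ j : ℕ), j < l.length →
    (vaddFn f l j₀).getD j 0 = l.getD j 0 + f (j₀ + j)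
  | [], _, j, hj => by simp at hj
  | a :: l, j₀, 0, _ => by simp [vaddFn]
  | a :: l, j₀, j + 1, hj => by
    rw [vaddFn, List.getD_cons_succ, List.getD_cons_succ, vaddFn_getD f l (j₀ + 1) j (by simpa using hj)]
    congr 2; omega

/-- A conditional mask update. -/
theorem cond_vaddMask_getD (b : Bool) (k : ℤ) (l : List ℤ) (msk j : ℕ) (hj : j < l.length) :
    (cond b (vaddMask k l msk) l).getD j 0 = l.getD j 0 + Cert.bi b * (Cert.bi (tb msk j) * k) := by
  cases b
  · simp [Cert.bi]
  · simp only [cond_true, vaddMask_getD k l msk j hj, Cert.bi, if_true, one_mul]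

/-- A conditional mask update preserves the length. -/
@[simp] theorem cond_vaddMask_length (b : Bool) (k : ℤ) (l : List ℤ) (msk : ℕ) : (cond b (vaddMask k l msk) l).length = l.length := by
  cases b <;> simp

/-! ### Entry updates -/

/-- The closed form of a row coefficient. -/
theorem RowE.coef_eq (r : RowE) (i j : ℕ) :
    r.coef i j = (r.n : ℤ) * (Cert.bi (tb r.m1 i) * Cert.bi (tb r.m2 j)) - (r.n : ℤ) * (Cert.bi (tb r.m3 i) * Cert.bi (tb r.m4 j)) := by
  unfold RowE.coef Cert.bi
  cases tb r.m1 i <;> cases tb r.m2 j <;> cases tb r.m3 i <;> cases tb r.m4 j <;> simp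

/-- The closed form of a square coefficient. -/
theorem SqE.coef_eq (s : SqE) (i j : ℕ) : s.coef i j = -((s.n : ℤ) * s.u i * s.u j) := by
  unfold SqE.coef; split_ifs with h
  · rw [h]; ring
  · rfl

/-- Row update at `i`: adds `coef i j + coef j i` at every `j`. -/
def rowUpd (i : ℕ) (acc : List ℤ) (r : RowE) : List ℤ :=
  let a1 := cond (tb r.m1 i) (vaddMask r.n acc r.m2) acc
  let a2 := cond (tb r.m2 i) (vaddMask r.n a1 r.m1) a1
  let a3 := cond (tb r.m3 i) (vaddMask (-(r.n : ℤ)) a2 r.m4) a2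
  cond (tb r.m4 i) (vaddMask (-(r.n : ℤ)) a3 r.m3) a3

/-- `rowUpd` preserves the length. -/
@[simp] theorem rowUpd_length (i : ℕ) (acc : List ℤ) (r : RowE) : (rowUpd i acc r).length = acc.length := by
  simp [rowUpd]

/-- Entry `j` after a row update: `+ (coef i j + coef j i)`. -/
theorem rowUpd_getD (i : ℕ) (acc : List ℤ) (r : RowE) (j : ℕ) (hj : j < acc.length) :
    (rowUpd i acc r).getD j 0 = acc.getD j 0 + (r.coef i j + r.coef j i) := by
  simp only [rowUpd]
  rw [cond_vaddMask_getD _ _ _ _ _ (by simp; exact hj), cond_vaddMask_getD _ _ _ _ _ (by simp; exact hj),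
    cond_vaddMask_getD _ _ _ _ _ (by simp; exact hj), cond_vaddMask_getD _ _ _ _ _ hj, RowE.coef_eq, RowE.coef_eq]
  ring

/-- Square update at `i`: adds `coef i j + coef j i = −2·n·u_i·u_j` at every `j`. -/
def sqUpd (i : ℕ) (acc : List ℤ) (s : SqE) : List ℤ :=
  let ui := s.u i
  if ui = 0 then acc else vaddMask (2 * s.n * ui * s.b) (vaddMask (-(2 * s.n * ui * s.a)) acc s.m1) s.m2

/-- `sqUpd` preserves the length. -/
@[simp] theorem sqUpd_length (i : ℕ) (acc : List ℤ) (s : SqE) : (sqUpd i acc s).length = acc.length := by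
  simp only [sqUpd]; split_ifs <;> simp

/-- Entry `j` after a square update: `+ (coef i j + coef j i)`. -/
theorem sqUpd_getD (i : ℕ) (acc : List ℤ) (s : SqE) (j : ℕ) (hj : j < acc.length) :
    (sqUpd i acc s).getD j 0 = acc.getD j 0 + (s.coef i j + s.coef j i) := by
  rw [SqE.coef_eq, SqE.coef_eq]
  simp only [sqUpd]
  split_ifs with h
  · rw [h]; ring
  · rw [vaddMask_getD _ _ _ _ (by simp; exact hj), vaddMask_getD _ _ _ _ hj]
    have hu : s.u j = (s.a : ℤ) * Cert.bi (tb s.m1 j) - (s.b : ℤ) * Cert.bi (tb s.m2 j) := by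
      unfold SqE.u Cert.bi; cases tb s.m1 j <;> cases tb s.m2 j <;> simp
    rw [hu]; ring

namespace Cert

variable (c : Cert)

/-- `Σ_e n·G_e(i)` of a group (the inner sum of `linC`). -/
def gsum (es : List LinE) (i : ℕ) : ℤ := (es.map fun e => (e.n : ℤ) * c.G e i).sum

/-- Linear-group update at `i`: `acc_b += gsum(i)` (`= [b = j]·…` of `linC i j`) and, for the group keyed `i`, `acc_j += gsum(j)` (`linC j i`). -/
def linUpd (i : ℕ) (acc : List ℤ) (g : ℕ × List LinE) : List ℤ :=
  let a1 := vaddAt (c.gsum g.2 i) acc g.1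
  if g.1 = i then vaddFn (fun j => c.gsum g.2 j) a1 0 else a1

/-- `linUpd` preserves the length. -/
@[simp] theorem linUpd_length (i : ℕ) (acc : List ℤ) (g : ℕ × List LinE) : (c.linUpd i acc g).length = acc.length := by
  simp only [linUpd]; split_ifs <;> simp

/-- Entry `j` after a linear-group update: `+ [b = j]·gsum(i) + [b = i]·gsum(j)`. -/
theorem linUpd_getD (i : ℕ) (acc : List ℤ) (g : ℕ × List LinE) (j : ℕ) (hj : j < acc.length) :
    (c.linUpd i acc g).getD j 0 =
      acc.getD j 0 + ((if g.1 = j then c.gsum g.2 i else 0) + (if g.1 = i then c.gsum g.2 j else 0)) := by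
  by_cases h : g.1 = i
  · rw [show c.linUpd i acc g = vaddFn (fun j => c.gsum g.2 j) (vaddAt (c.gsum g.2 i) acc g.1) 0 by simp [linUpd, h],
      vaddFn_getD _ _ _ _ (by simp; exact hj), vaddAt_getD _ _ _ _ hj, Nat.zero_add, if_pos h]; ring
  · rw [show c.linUpd i acc g = vaddAt (c.gsum g.2 i) acc g.1 by simp [linUpd, h], vaddAt_getD _ _ _ _ hj, if_neg h]; ring

/-! ### Folds -/

/-- A list sum of sums splits. -/
theorem listSum_add {α : Type*} (l : List α) (f g : α → ℤ) :
    (l.map fun a => f a + g a).sum = (l.map f).sum + (l.map g).sum := by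
  induction l with
  | nil => simp
  | cons a l ih => simp only [List.map_cons, List.sum_cons, ih]; ring

/-- Generic fold lemma, lengths: a length-preserving update keeps the length along a fold. -/
theorem foldl_length {α : Type*} (upd : List ℤ → α → List ℤ) (hlen : ∀ acc a, (upd acc a).length = acc.length) :
    ∀ (l : List α) (acc : List ℤ), (l.foldl upd acc).length = acc.length
  | [], acc => rfl
  | a :: l, acc => by rw [List.foldl_cons, foldl_length upd hlen l, hlen]

/-- Generic fold lemma, entries: an update adding `φ a j` at position `j` accumulates `Σ_a φ a j`. -/
theorem foldl_getD {α : Type*} (upd : List ℤ → α → List ℤ) (φ : α → ℕ → ℤ)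
    (hlen : ∀ acc a, (upd acc a).length = acc.length)
    (hget : ∀ acc a j, j < acc.length → (upd acc a).getD j 0 = acc.getD j 0 + φ a j) :
    ∀ (l : List α) (acc : List ℤ) (j : ℕ), j < acc.length →
      (l.foldl upd acc).getD j 0 = acc.getD j 0 + (l.map fun a => φ a j).sum
  | [], acc, j, _ => by simp
  | a :: l, acc, j, hj => by
    rw [List.foldl_cons, foldl_getD upd φ hlen hget l (upd acc a) j (by rw [hlen]; exact hj), hget acc a j hj, List.map_cons,
      List.sum_cons]
    ring

/-- All rows, chunk by chunk. -/
def rowsV (i : ℕ) (acc : List ℤ) : List ℤ := c.rows.foldl (fun a ch => ch.foldl (rowUpd i) a) acc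

/-- All squares. -/
def sqsV (i : ℕ) (acc : List ℤ) : List ℤ := c.sqs.foldl (fun a ch => ch.foldl (sqUpd i) a) acc

/-- All linear groups. -/
def linV (i : ℕ) (acc : List ℤ) : List ℤ := c.lin.foldl (c.linUpd i) acc

/-- **Row `i` of the symmetrised coefficient array**, as a list of length `NV`. -/
def svec (i : ℕ) : List ℤ := c.linV i (c.sqsV i (c.rowsV i (List.replicate c.NV 0)))

/-- `rowsV` preserves the length. -/
@[simp] theorem rowsV_length (i : ℕ) (acc : List ℤ) : (c.rowsV i acc).length = acc.length :=
  foldl_length _ (fun acc ch => foldl_length _ (rowUpd_length i) ch acc) c.rows acc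

/-- Entry `j` after all rows: `+ (rowC i j + rowC j i)`. -/
theorem rowsV_getD (i : ℕ) (acc : List ℤ) (j : ℕ) (hj : j < acc.length) :
    (c.rowsV i acc).getD j 0 = acc.getD j 0 + (c.rowC i j + c.rowC j i) := by
  rw [rowsV, foldl_getD (fun a (ch : List RowE) => ch.foldl (rowUpd i) a)
    (fun ch j => (ch.map fun r => r.coef i j).sum + (ch.map fun r => r.coef j i).sum)
    (fun acc ch => foldl_length _ (rowUpd_length i) ch acc)
    (fun acc ch j hj => by rw [foldl_getD (rowUpd i) (fun r j => r.coef i j + r.coef j i) (rowUpd_length i) (rowUpd_getD i) ch acc j hj,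
      listSum_add]) c.rows acc j hj, rowC, rowC, listSum_add]

/-- `sqsV` preserves the length. -/
@[simp] theorem sqsV_length (i : ℕ) (acc : List ℤ) : (c.sqsV i acc).length = acc.length :=
  foldl_length _ (fun acc ch => foldl_length _ (sqUpd_length i) ch acc) c.sqs acc

/-- Entry `j` after all squares: `+ (sqC i j + sqC j i)`. -/
theorem sqsV_getD (i : ℕ) (acc : List ℤ) (j : ℕ) (hj : j < acc.length) :
    (c.sqsV i acc).getD j 0 = acc.getD j 0 + (c.sqC i j + c.sqC j i) := by
  rw [sqsV, foldl_getD (fun a (ch : List SqE) => ch.foldl (sqUpd i) a)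
    (fun ch j => (ch.map fun s => s.coef i j).sum + (ch.map fun s => s.coef j i).sum)
    (fun acc ch => foldl_length _ (sqUpd_length i) ch acc)
    (fun acc ch j hj => by rw [foldl_getD (sqUpd i) (fun s j => s.coef i j + s.coef j i) (sqUpd_length i) (sqUpd_getD i) ch acc j hj,
      listSum_add]) c.sqs acc j hj, sqC, sqC, listSum_add]

/-- `linV` preserves the length. -/
@[simp] theorem linV_length (i : ℕ) (acc : List ℤ) : (c.linV i acc).length = acc.length :=
  foldl_length _ (c.linUpd_length i) c.lin acc

/-- Entry `j` after all linear groups: `+ (linC i j + linC j i)`. -/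
theorem linV_getD (i : ℕ) (acc : List ℤ) (j : ℕ) (hj : j < acc.length) :
    (c.linV i acc).getD j 0 = acc.getD j 0 + (c.linC i j + c.linC j i) := by
  rw [linV, foldl_getD (c.linUpd i) (fun g j => (if g.1 = j then c.gsum g.2 i else 0) + (if g.1 = i then c.gsum g.2 j else 0))
    (c.linUpd_length i) (c.linUpd_getD i) c.lin acc j hj, listSum_add]
  rfl

/-- `svec i` has length `NV`. -/
@[simp] theorem svec_length (i : ℕ) : (c.svec i).length = c.NV := by simp [svec]

/-- **The vector evaluation computes the specification:** entry `j` of `svec i` is `S i j`. -/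
theorem svec_getD (i j : ℕ) (hj : j < c.NV) : (c.svec i).getD j 0 = c.S i j := by
  unfold svec
  have h0 : (List.replicate c.NV (0 : ℤ)).getD j 0 = 0 := by
    rw [List.getD_eq_getElem _ _ (by simpa using hj)]; simp
  rw [c.linV_getD i _ j (by simp; exact hj), c.sqsV_getD i _ j (by simp; exact hj), c.rowsV_getD i _ j (by simp; exact hj), h0]
  unfold S C; ring

/-! ### The quadratic check -/

/-- **The quadratic check** on the rows `lo ≤ i < hi`: every entry of `svec i` is nonnegative. -/
def checkQ (lo hi : ℕ) : Bool := (List.range' lo (hi - lo)).all fun i => (c.svec i).all fun x => decide (0 ≤ x)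

/-- **The full check.** -/
def check : Bool := c.checkW && c.checkQ 0 c.NV

/-- The quadratic check on `[lo, hi)` yields `S i j ≥ 0` for its rows. -/
theorem of_checkQ {lo hi : ℕ} (hq : c.checkQ lo hi = true) {i j : ℕ} (hlo : lo ≤ i) (hhi : i < hi) (hj : j < c.NV) :
    0 ≤ c.S i j := by
  unfold checkQ at hq
  rw [List.all_eq_true] at hq
  have h1 := hq i (by rw [List.mem_range'_1]; omega)
  rw [List.all_eq_true] at h1
  have hmem : (c.svec i).getD j 0 ∈ c.svec i := by
    rw [List.getD_eq_getElem _ _ (by rw [svec_length]; exact hj)]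
    exact List.getElem_mem _
  have h2 := of_decide_eq_true (h1 _ hmem)
  rwa [c.svec_getD i j hj] at h2

/-- Assembling the quadratic check from two consecutive ranges. -/
theorem checkQ_append {lo mid hi : ℕ} (h1 : c.checkQ lo mid = true) (h2 : c.checkQ mid hi = true) : c.checkQ lo hi = true := by
  unfold checkQ at *
  rw [List.all_eq_true] at *
  intro i hi'
  rw [List.mem_range'_1] at hi'
  by_cases him : i < mid
  · exact h1 i (by rw [List.mem_range'_1]; omega)
  · exact h2 i (by rw [List.mem_range'_1]; omega)

end Cert

end QCert
end HubOnly

end Summit.CriticalPhenomena.PercolationContinuityZ3.Theorems
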